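import Mathlib.Analysis.SpecialFunctions.Pow.Asymptotics
import Mathlib.Analysis.SpecialFunctions.Log.Base
import Mathlib.Analysis.SpecialFunctions.Sqrt
import HarnessLib

/-!
# Route `ChenParityOracleBLAP` — crux S1 = `HostParityFromBrick` (stmt-Parity-20045): Type-I sums — final numerics

Support file for the prime half `K1 → K2 → HP1` of S1 (unconditional Type-I input): the elementary
real inequalities showing that every term of the explicit Type-I bound (`typeI_large_static`,
`typeI_small_d`, the divisor-switch boundary `R·D`) is at most `x/(4 (log x)^A)` for large `x`,
and the collection of the corresponding "eventually" thresholds (`typeI_thresholds`).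

References: H. Iwaniec, E. Kowalski, *Analytic Number Theory* (2004), §17.3 [IwaniecKowalski2004].
-/

namespace Summit.Parity.GeneralizedHardyLittlewood.Theorems

open Real Filter

/-- Term `T₁`: `√C (4/L)^{A+3}(y+2)(1+L)(2√(1+L)+8y^{-ε}) ≤ y/(4L^A)` once
`L = log y ≥ max 1 (192 √C 4^{A+3})`, `y ≥ 2`. -/
theorem typeI_T1_le {A C ε y : ℝ} (hε : 0 < ε) (hy : 2 ≤ y)
    (hL1 : 1 ≤ Real.log y) (hK : 192 * Real.sqrt C * (4 : ℝ) ^ (A + 3) ≤ Real.log y) :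
    Real.sqrt C * (4 / Real.log y) ^ (A + 3) * (y + 2) * (1 + Real.log y) *
        (2 * Real.sqrt (1 + Real.log y) + 8 * y ^ (-ε)) ≤ y / (4 * Real.log y ^ A) := by
  set L := Real.log y with hL
  have hL0 : 0 < L := by linarith
  have hy0 : 0 < y := by linarith
  have h4 : (4 / L) ^ (A + 3) = (4 : ℝ) ^ (A + 3) / (L ^ A * L ^ 3) := by
    rw [Real.div_rpow (by norm_num) hL0.le, Real.rpow_add hL0, show (3 : ℝ) = ((3 : ℕ) : ℝ) by norm_num,
      Real.rpow_natCast]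
  have hsq : Real.sqrt (1 + L) ≤ 1 + L := by
    have h1 : 1 ≤ 1 + L := by linarith
    calc Real.sqrt (1 + L) ≤ Real.sqrt ((1 + L) ^ 2) := Real.sqrt_le_sqrt (by nlinarith)
      _ = 1 + L := Real.sqrt_sq (by linarith)
  have hyε : y ^ (-ε) ≤ 1 := Real.rpow_le_one_of_one_le_of_nonpos (by linarith) (by linarith)
  have hlast : 2 * Real.sqrt (1 + L) + 8 * y ^ (-ε) ≤ 12 * L := by linarith
  have hLA : 0 < L ^ A := Real.rpow_pos_of_pos hL0 _
  have h43 : 0 < (4 : ℝ) ^ (A + 3) := Real.rpow_pos_of_pos (by norm_num) _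
  rw [h4]
  -- LHS ≤ √C 4^{A+3}/(L^A L^3) · 2y · 2L · 12L = 48 √C 4^{A+3} y /(L^A L)
  have hstep : Real.sqrt C * ((4 : ℝ) ^ (A + 3) / (L ^ A * L ^ 3)) * (y + 2) * (1 + L) *
      (2 * Real.sqrt (1 + L) + 8 * y ^ (-ε)) ≤
      Real.sqrt C * ((4 : ℝ) ^ (A + 3) / (L ^ A * L ^ 3)) * (2 * y) * (2 * L) * (12 * L) := by
    have h0 : 0 ≤ Real.sqrt C * ((4 : ℝ) ^ (A + 3) / (L ^ A * L ^ 3)) := by positivity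
    have h1 : y + 2 ≤ 2 * y := by linarith
    have h2 : 1 + L ≤ 2 * L := by linarith
    have hl0 : 0 ≤ 2 * Real.sqrt (1 + L) + 8 * y ^ (-ε) := by positivity
    calc _ ≤ Real.sqrt C * ((4 : ℝ) ^ (A + 3) / (L ^ A * L ^ 3)) * (2 * y) * (2 * L) *
          (2 * Real.sqrt (1 + L) + 8 * y ^ (-ε)) := by
          apply mul_le_mul_of_nonneg_right _ hl0
          exact mul_le_mul (mul_le_mul_of_nonneg_left h1 h0) h2 (by linarith) (by positivity)
      _ ≤ _ := mul_le_mul_of_nonneg_left hlast (by positivity)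
  refine hstep.trans ?_
  have e : Real.sqrt C * ((4 : ℝ) ^ (A + 3) / (L ^ A * L ^ 3)) * (2 * y) * (2 * L) * (12 * L) =
      (48 * Real.sqrt C * (4 : ℝ) ^ (A + 3) / L) * (y / L ^ A) := by
    field_simp; ring
  rw [e, show y / (4 * L ^ A) = (1 / 4) * (y / L ^ A) by field_simp]
  refine mul_le_mul_of_nonneg_right ?_ (by positivity)
  rw [div_le_iff₀ hL0]
  linarith

/-- Term `T₂`: `(1+L)((y+2)y^{-ε}(1+L) + y^{1/3}(1+L) + 2√y) ≤ y/(4L^A)` once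
`64 L^{A+2} ≤ y^{ε}` (`L = log y ≥ 1`, `y ≥ 2`, `0 < ε ≤ 1/2`). -/
theorem typeI_T2_le {A ε y : ℝ} (hε : 0 < ε) (hε' : ε ≤ 1 / 2) (hy : 2 ≤ y)
    (hL1 : 1 ≤ Real.log y) (hK : 64 * Real.log y ^ (A + 2) ≤ y ^ ε) :
    (1 + Real.log y) * ((y + 2) * y ^ (-ε) * (1 + Real.log y) +
        y ^ (1 / 3 : ℝ) * (1 + Real.log y) + 2 * Real.sqrt y) ≤ y / (4 * Real.log y ^ A) := by
  set L := Real.log y with hL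
  have hL0 : 0 < L := by linarith
  have hy0 : 0 < y := by linarith
  have hy1 : 1 ≤ y := by linarith
  have hLA : 0 < L ^ A := Real.rpow_pos_of_pos hL0 _
  set P := y ^ (1 - ε) with hP
  have hP0 : 0 < P := Real.rpow_pos_of_pos hy0 _
  have hyP : y * y ^ (-ε) = P := by
    rw [hP, show (1 : ℝ) - ε = 1 + -ε by ring, Real.rpow_add hy0, Real.rpow_one]
  have h13 : y ^ (1 / 3 : ℝ) ≤ P := Real.rpow_le_rpow_of_exponent_le hy1 (by linarith)
  have hsqrt : Real.sqrt y ≤ P := by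
    rw [Real.sqrt_eq_rpow]; exact Real.rpow_le_rpow_of_exponent_le hy1 (by linarith)
  have hyε0 : 0 ≤ y ^ (-ε) := by positivity
  -- inner ≤ 8 L P
  have hinner : (y + 2) * y ^ (-ε) * (1 + L) + y ^ (1 / 3 : ℝ) * (1 + L) + 2 * Real.sqrt y ≤
      8 * L * P := by
    have h1 : (y + 2) * y ^ (-ε) ≤ 2 * P := by
      calc (y + 2) * y ^ (-ε) ≤ (2 * y) * y ^ (-ε) := by gcongr; linarith
        _ = 2 * P := by rw [mul_assoc, hyP]
    have h2 : (y + 2) * y ^ (-ε) * (1 + L) ≤ 2 * P * (2 * L) :=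
      mul_le_mul h1 (by linarith) (by linarith) (by positivity)
    have h3 : y ^ (1 / 3 : ℝ) * (1 + L) ≤ P * (2 * L) :=
      mul_le_mul h13 (by linarith) (by linarith) hP0.le
    nlinarith
  have hPL : 64 * L ^ A * L ^ 2 * P ≤ y := by
    have h1 : L ^ (A + 2) = L ^ A * L ^ 2 := by
      rw [Real.rpow_add hL0, show (2 : ℝ) = ((2 : ℕ) : ℝ) by norm_num, Real.rpow_natCast]
    have h2 : y ^ ε * P = y := by
      rw [hP, ← Real.rpow_add hy0, show ε + (1 - ε) = 1 by ring, Real.rpow_one]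
    calc 64 * L ^ A * L ^ 2 * P = (64 * L ^ (A + 2)) * P := by rw [h1]; ring
      _ ≤ y ^ ε * P := mul_le_mul_of_nonneg_right hK hP0.le
      _ = y := h2
  calc (1 + L) * ((y + 2) * y ^ (-ε) * (1 + L) + y ^ (1 / 3 : ℝ) * (1 + L) + 2 * Real.sqrt y)
      ≤ (2 * L) * (8 * L * P) := mul_le_mul (by linarith) hinner (by positivity) (by positivity)
    _ = 16 * L ^ 2 * P := by ring
    _ ≤ y / (4 * L ^ A) := by rw [le_div_iff₀ (by positivity)]; nlinarith

/-- Term `T₃` and the switch boundary: `2 y^{5/6} ≤ y/(4 L^A)` once `8 L^A ≤ y^{1/6}`. -/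
theorem typeI_T3_le {A y : ℝ} (hy : 1 ≤ y)
    (hK : 8 * Real.log y ^ A ≤ y ^ (1 / 6 : ℝ)) (hLA : 0 < Real.log y ^ A) :
    2 * y ^ (5 / 6 : ℝ) ≤ y / (4 * Real.log y ^ A) := by
  have hy0 : 0 < y := by linarith
  rw [le_div_iff₀ (by positivity)]
  have h56 : 0 < y ^ (5 / 6 : ℝ) := Real.rpow_pos_of_pos hy0 _
  calc 2 * y ^ (5 / 6 : ℝ) * (4 * Real.log y ^ A) = (8 * Real.log y ^ A) * y ^ (5 / 6 : ℝ) := by ring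
    _ ≤ y ^ (1 / 6 : ℝ) * y ^ (5 / 6 : ℝ) := mul_le_mul_of_nonneg_right hK h56.le
    _ = y := by rw [← Real.rpow_add hy0]; norm_num

/-- Small moduli: `Cs y (1+L)/L^{A+2} ≤ y/(4 L^A)` once `L ≥ max 1 (8 Cs)`. -/
theorem typeI_small_le {A Cs y : ℝ} (hy : 0 ≤ y) (hL1 : 1 ≤ Real.log y)
    (hK : 8 * Cs ≤ Real.log y) :
    Cs * y * (1 + Real.log y) / Real.log y ^ (A + 2) ≤ y / (4 * Real.log y ^ A) := by
  set L := Real.log y with hL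
  have hL0 : 0 < L := by linarith
  have hLA : 0 < L ^ A := Real.rpow_pos_of_pos hL0 _
  have h1 : L ^ (A + 2) = L ^ A * L ^ 2 := by
    rw [Real.rpow_add hL0, show (2 : ℝ) = ((2 : ℕ) : ℝ) by norm_num, Real.rpow_natCast]
  rw [h1, div_le_div_iff₀ (by positivity) (by positivity)]
  -- `Cs y (1+L) · 4 L^A ≤ y · L^A L^2`
  have h2 : Cs * (1 + L) * 4 ≤ L ^ 2 := by nlinarith
  have := mul_le_mul_of_nonneg_left h2 (mul_nonneg hy hLA.le)
  nlinarith [this]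

/-- **Thresholds.**  For `A, ε_T > 0` and constants `Cs, C ≥ 0`, `xs, X₀`, eventually (in `y`):
`xs ≤ y`, `2^10 ≤ y`, `X₀ ≤ √y/3`, `2 y^{1/3} ≤ (√y/3)^{3/4}`, `1 ≤ log y`,
`192 √C 4^{A+3} ≤ log y`, `64 (log y)^{A+2} ≤ y^{ε_T}`, `8 (log y)^A ≤ y^{1/6}`, `8 Cs ≤ log y`. -/
theorem typeI_thresholds (A εT Cs C xs X₀ : ℝ) (hεT : 0 < εT) :
    ∃ y₀ : ℝ, ∀ y : ℝ, y₀ ≤ y → xs ≤ y ∧ (2 : ℝ) ^ 10 ≤ y ∧ X₀ ≤ Real.sqrt y / 3 ∧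
      2 * y ^ (1 / 3 : ℝ) ≤ (Real.sqrt y / 3) ^ (3 / 4 : ℝ) ∧ 1 ≤ Real.log y ∧
      192 * Real.sqrt C * (4 : ℝ) ^ (A + 3) ≤ Real.log y ∧
      64 * Real.log y ^ (A + 2) ≤ y ^ εT ∧ 8 * Real.log y ^ A ≤ y ^ (1 / 6 : ℝ) ∧
      8 * Cs ≤ Real.log y := by
  have hlog : Tendsto Real.log atTop atTop := Real.tendsto_log_atTop
  have e1 : ∀ᶠ y : ℝ in atTop, xs ≤ y := eventually_ge_atTop xs
  have e2 : ∀ᶠ y : ℝ in atTop, (2 : ℝ) ^ 10 ≤ y := eventually_ge_atTop _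
  have e3 : ∀ᶠ y : ℝ in atTop, X₀ ≤ Real.sqrt y / 3 := by
    have h : Tendsto (fun y : ℝ => y ^ (1 / 2 : ℝ) / 3) atTop atTop :=
      (tendsto_rpow_atTop (by norm_num)).atTop_div_const (by norm_num)
    filter_upwards [h.eventually_ge_atTop X₀] with y hy
    rwa [Real.sqrt_eq_rpow]
  have e4 : ∀ᶠ y : ℝ in atTop, 2 * y ^ (1 / 3 : ℝ) ≤ (Real.sqrt y / 3) ^ (3 / 4 : ℝ) := by
    filter_upwards [(tendsto_rpow_atTop (by norm_num : (0 : ℝ) < 1 / 24)).eventually_ge_atTop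
      (2 * (3 : ℝ) ^ (3 / 4 : ℝ)), eventually_ge_atTop (1 : ℝ)] with y hy hy1
    have hy0 : 0 ≤ y := by linarith
    have h3 : 0 < (3 : ℝ) ^ (3 / 4 : ℝ) := Real.rpow_pos_of_pos (by norm_num) _
    rw [Real.sqrt_eq_rpow, Real.div_rpow (by positivity) (by norm_num), ← Real.rpow_mul hy0,
      show (1 / 2 : ℝ) * (3 / 4) = 1 / 3 + 1 / 24 by norm_num, Real.rpow_add' hy0 (by norm_num),
      le_div_iff₀ h3]
    have h13 : 0 ≤ y ^ (1 / 3 : ℝ) := by positivity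
    calc 2 * y ^ (1 / 3 : ℝ) * (3 : ℝ) ^ (3 / 4 : ℝ) = y ^ (1 / 3 : ℝ) * (2 * (3 : ℝ) ^ (3 / 4 : ℝ)) := by
          ring
      _ ≤ y ^ (1 / 3 : ℝ) * y ^ (1 / 24 : ℝ) := mul_le_mul_of_nonneg_left hy h13
  have e5 : ∀ᶠ y : ℝ in atTop, 1 ≤ Real.log y := hlog.eventually_ge_atTop 1
  have e6 : ∀ᶠ y : ℝ in atTop, 192 * Real.sqrt C * (4 : ℝ) ^ (A + 3) ≤ Real.log y :=
    hlog.eventually_ge_atTop _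
  have e7 : ∀ᶠ y : ℝ in atTop, 64 * Real.log y ^ (A + 2) ≤ y ^ εT := by
    have h := (isLittleO_log_rpow_rpow_atTop (A + 2) hεT).bound (show (0:ℝ) < 1 / 64 by norm_num)
    filter_upwards [h, eventually_ge_atTop (1 : ℝ)] with y hy hy1
    rw [Real.norm_of_nonneg (Real.rpow_nonneg (Real.log_nonneg hy1) _),
      Real.norm_of_nonneg (Real.rpow_nonneg (by linarith) _)] at hy
    linarith
  have e8 : ∀ᶠ y : ℝ in atTop, 8 * Real.log y ^ A ≤ y ^ (1 / 6 : ℝ) := by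
    have h := (isLittleO_log_rpow_rpow_atTop A (by norm_num : (0:ℝ) < 1 / 6)).bound
      (show (0:ℝ) < 1 / 8 by norm_num)
    filter_upwards [h, eventually_ge_atTop (1 : ℝ)] with y hy hy1
    rw [Real.norm_of_nonneg (Real.rpow_nonneg (Real.log_nonneg hy1) _),
      Real.norm_of_nonneg (Real.rpow_nonneg (by linarith) _)] at hy
    linarith
  have e9 : ∀ᶠ y : ℝ in atTop, 8 * Cs ≤ Real.log y := hlog.eventually_ge_atTop _
  obtain ⟨y₀, hy₀⟩ := Filter.eventually_atTop.mp
    (e1.and (e2.and (e3.and (e4.and (e5.and (e6.and (e7.and (e8.and e9))))))))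
  exact ⟨y₀, fun y hy => hy₀ y hy⟩

end Summit.Parity.GeneralizedHardyLittlewood.Theorems
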